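import Summits.HubbardSuperconductivity.HubbardLadder.Bounds.CouplingPolymerGas
import Mathlib
import HarnessLib

/-!
# The polymer representation of an abstract factorising Gibbs functional (K2 groundwork, part 4)

Helper file for route `TcThermcert1`, crux `ThermalStiffnessCeilingU8b10_le_1o8` (item `stmt-Ventures-26381`), line
`Cruxes/ThermalStiffnessCeilingU8b10_le_1o8/Lines/zerofree_corridor.lean` v9, registered stub K2 `stub_gcHighTempAnalytic`, step S3 of
`Cruxes/…/STUB-PLAN-stub_gcHighTempAnalytic.md`.

The combinatorial half of Ueltschi's polymer representation, ABSTRACTED from the one-chemical-potential Gibbs factor `Zc β U μ` of the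
tree (`Literature…HubbardPolymerRepresentation`, cell pub-hubbard `Bounds/CouplingPolymerGas.Zc_eq_mul_polymerPartitionFunctionC`) to ANY
functional `T : (Bond Λ → ℂ) → ℂ` of complex bond couplings with `T 0 ≠ 0` and the factorisation property
`T(c₁ + c₂) · T(0) = T(c₁) · T(c₂)` for couplings on bonds inside disjoint site sets (`hfac`; for the two-fugacity generalised Gibbs factor
of K2 this is part 3, `TcThermcert1GcGibbsFactorization.trace_exp_twoFugacity_add_mul`):

* `ratio_add_of_factorising` — multiplicativity of the normalised factor `g(c) = T(c)/T(0)`;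
* the bond weights `M_c(K) = Σ_{K' ⊆ K} (−1)^{|K∖K'|} g(c|_{K'})` (`restrictCoupling` of the cell file; any `W` agreeing with this sum, `hW`):
  `weight_empty_of_factorising`, `weight_union_of_factorising` (multiplicative over bond sets with disjoint supports);
* **the polymer representation** `T(c) = T(0) · Ξ^{polyInc}_{𝒫(Λ)}(ρ_c)` with the site activity
  `ρ_c = pushforwardActivity supp M_c (connected bond sets ⊆ P)` for every bond universe `P ⊇ supp c`
  (`eq_mul_polymerPartitionFunction_of_factorising`; Möbius inversion
  `ClusterExpansion.sum_powerset_sum_powerset_neg_one_pow_card_sdiff_mul`,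
  component decomposition and pushforward `PolymerPushforward.sum_powerset_eq_polymerPartitionFunction_cellSupp`) — the proofs are the cell
  file's, with `g` for `gibbsRatio`.

[cite: Ueltschi1999, §2.3 (polymers and their weights ρ(𝒜); Tr e^{-βH_Λ} = e^{-βf₀|Λ|} Σ Π ρ(𝒜_j))] Finite combinatorics;
no physics claim — nothing about superconductivity in the Hubbard model is proved by anything in this file. No definitions; no `sorry`.
-/

noncomputable section

namespace Summit.Ventures.CertifiedManyBodySolver.Theorems.TcThermcert1.ZeroFreeCorridor

open Matrix Finset Complex
open Literature.MathematicalPhysics.QuantumLattice Literature.Probability.LatticeModels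
open Summit.HubbardSuperconductivity.HubbardLadder.Bounds

variable {Λ : Type*} [LinearOrder Λ] [Fintype Λ]

omit [LinearOrder Λ] [Fintype Λ] in
/-- **Multiplicativity of the normalised factor** `g(c) = T(c)/T(0)` over couplings with disjoint supports, from the factorisation
property `hfac` and `T 0 ≠ 0` (pattern of `gibbsRatio_add`). -/
theorem ratio_add_of_factorising (T : (Bond Λ → ℂ) → ℂ) (h0 : T 0 ≠ 0)
    (hfac : ∀ ⦃A₁ A₂ : Finset Λ⦄, Disjoint A₁ A₂ → ∀ ⦃c₁ c₂ : Bond Λ → ℂ⦄,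
      (∀ b, c₁ b ≠ 0 → b.1 ∈ A₁ ∧ b.2.1 ∈ A₁) → (∀ b, c₂ b ≠ 0 → b.1 ∈ A₂ ∧ b.2.1 ∈ A₂) →
      T (c₁ + c₂) * T 0 = T c₁ * T c₂)
    {A₁ A₂ : Finset Λ} (hA : Disjoint A₁ A₂) {c₁ c₂ : Bond Λ → ℂ} (hc₁ : ∀ b, c₁ b ≠ 0 → b.1 ∈ A₁ ∧ b.2.1 ∈ A₁)
    (hc₂ : ∀ b, c₂ b ≠ 0 → b.1 ∈ A₂ ∧ b.2.1 ∈ A₂) : T (c₁ + c₂) / T 0 = T c₁ / T 0 * (T c₂ / T 0) := by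
  have h := hfac hA hc₁ hc₂
  rw [div_mul_div_comm, eq_div_iff (mul_ne_zero h0 h0), div_mul_eq_mul_div, div_eq_iff h0]
  linear_combination T 0 * h

omit [Fintype Λ] in
/-- `M_c(∅) = 1` (pattern of `bondWeightC_empty`). -/
theorem weight_empty_of_factorising (T : (Bond Λ → ℂ) → ℂ) (h0 : T 0 ≠ 0) (c : Bond Λ → ℂ) (W : Finset (Bond Λ) → ℂ)
    (hW : ∀ K, W K = ∑ K' ∈ K.powerset, (-1) ^ (K \ K').card * (T (restrictCoupling c K') / T 0)) :
    W ∅ = 1 := by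
  rw [hW, Finset.powerset_empty, Finset.sum_singleton, Finset.sdiff_self, Finset.card_empty, pow_zero, one_mul,
    restrictCoupling_empty, div_self h0]

omit [Fintype Λ] in
/-- **Multiplicativity of the bond weights** `M_c(K₁ ∪ K₂) = M_c(K₁) M_c(K₂)` whenever the supports of `K₁`, `K₂` are disjoint
(pattern of `bondWeightC_union`). -/
theorem weight_union_of_factorising (T : (Bond Λ → ℂ) → ℂ) (h0 : T 0 ≠ 0)
    (hfac : ∀ ⦃A₁ A₂ : Finset Λ⦄, Disjoint A₁ A₂ → ∀ ⦃c₁ c₂ : Bond Λ → ℂ⦄,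
      (∀ b, c₁ b ≠ 0 → b.1 ∈ A₁ ∧ b.2.1 ∈ A₁) → (∀ b, c₂ b ≠ 0 → b.1 ∈ A₂ ∧ b.2.1 ∈ A₂) →
      T (c₁ + c₂) * T 0 = T c₁ * T c₂)
    (c : Bond Λ → ℂ) (W : Finset (Bond Λ) → ℂ)
    (hW : ∀ K, W K = ∑ K' ∈ K.powerset, (-1) ^ (K \ K').card * (T (restrictCoupling c K') / T 0))
    {K₁ K₂ : Finset (Bond Λ)} (h : Disjoint (cellSupp Bond.verts K₁) (cellSupp Bond.verts K₂)) :
    W (K₁ ∪ K₂) = W K₁ * W K₂ := by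
  have hK : Disjoint K₁ K₂ := disjoint_of_disjoint_cellSupp h
  rw [hW, hW, hW, sum_powerset_union_eq_sum_sum hK, Finset.sum_mul_sum]
  refine Finset.sum_congr rfl fun K₁' h₁ => Finset.sum_congr rfl fun K₂' h₂ => ?_
  have h₁' : K₁' ⊆ K₁ := Finset.mem_powerset.1 h₁
  have h₂' : K₂' ⊆ K₂ := Finset.mem_powerset.1 h₂
  have hK' : Disjoint K₁' K₂' := Finset.disjoint_of_subset_left h₁' (Finset.disjoint_of_subset_right h₂' hK)
  have hsd : Disjoint (K₁ \ K₁') (K₂ \ K₂') :=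
    Finset.disjoint_of_subset_left Finset.sdiff_subset (Finset.disjoint_of_subset_right Finset.sdiff_subset hK)
  have hc₁ : ∀ b, restrictCoupling c K₁' b ≠ 0 → b.1 ∈ cellSupp Bond.verts K₁ ∧ b.2.1 ∈ cellSupp Bond.verts K₁ :=
    fun b hb => endpoints_mem_cellSupp (h₁' (mem_of_restrictCoupling_ne_zero hb))
  have hc₂ : ∀ b, restrictCoupling c K₂' b ≠ 0 → b.1 ∈ cellSupp Bond.verts K₂ ∧ b.2.1 ∈ cellSupp Bond.verts K₂ :=
    fun b hb => endpoints_mem_cellSupp (h₂' (mem_of_restrictCoupling_ne_zero hb))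
  rw [union_sdiff_union_eq hK h₁' h₂', Finset.card_union_of_disjoint hsd, pow_add, restrictCoupling_union c hK',
    ratio_add_of_factorising T h0 hfac h hc₁ hc₂]
  ring

/-- **The polymer representation of a factorising Gibbs functional** (Ueltschi §2.3, abstract form): for every bond set `P`
containing the support of `c`, `T(c) = T(0) · Ξ^{polyInc}_{𝒫(Λ)}(ρ_c)` with the site activity
`ρ_c = pushforwardActivity supp M_c (connected bond sets ⊆ P)` (pattern of `Zc_eq_mul_polymerPartitionFunctionC`). -/
theorem eq_mul_polymerPartitionFunction_of_factorising (T : (Bond Λ → ℂ) → ℂ) (h0 : T 0 ≠ 0)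
    (hfac : ∀ ⦃A₁ A₂ : Finset Λ⦄, Disjoint A₁ A₂ → ∀ ⦃c₁ c₂ : Bond Λ → ℂ⦄,
      (∀ b, c₁ b ≠ 0 → b.1 ∈ A₁ ∧ b.2.1 ∈ A₁) → (∀ b, c₂ b ≠ 0 → b.1 ∈ A₂ ∧ b.2.1 ∈ A₂) →
      T (c₁ + c₂) * T 0 = T c₁ * T c₂)
    (c : Bond Λ → ℂ) (W : Finset (Bond Λ) → ℂ)
    (hW : ∀ K, W K = ∑ K' ∈ K.powerset, (-1) ^ (K \ K').card * (T (restrictCoupling c K') / T 0))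
    (P : Finset (Bond Λ)) (hP : ∀ b, c b ≠ 0 → b ∈ P) :
    T c = T 0 * polymerPartitionFunction polyInc (pushforwardActivity (cellSupp Bond.verts) W (connectedCellSets Bond.verts P))
      (Finset.univ : Finset Λ).powerset := by
  have h1 : T c = T 0 * (T (restrictCoupling c P) / T 0) := by
    rw [restrictCoupling_eq_self hP, mul_div_cancel₀ _ h0]
  have h2 : T (restrictCoupling c P) / T 0 = ∑ K ∈ P.powerset, W K := by
    rw [← sum_powerset_sum_powerset_neg_one_pow_card_sdiff_mul (M := ℂ) (fun K => T (restrictCoupling c K) / T 0) P]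
    exact Finset.sum_congr rfl fun K _ => (hW K).symm
  have h3 := sum_powerset_eq_polymerPartitionFunction_cellSupp (verts := (Bond.verts : Bond Λ → Finset Λ))
    verts_nonempty W (weight_empty_of_factorising T h0 c W hW) (fun K₁ K₂ h => weight_union_of_factorising T h0 hfac c W hW h) P
  have h4 : polymerPartitionFunction polyInc (pushforwardActivity (cellSupp Bond.verts) W (connectedCellSets Bond.verts P))
      (Finset.univ : Finset Λ).powerset =
      polymerPartitionFunction polyInc (pushforwardActivity (cellSupp Bond.verts) W (connectedCellSets Bond.verts P))
        ((connectedCellSets Bond.verts P).image (cellSupp Bond.verts)) :=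
    polymerPartitionFunction_eq_of_subset_of_eq_zero (fun A _ => Finset.mem_powerset.2 (Finset.subset_univ _))
      fun A _ hA => pushforwardActivity_eq_zero_of_not_mem_image hA
  rw [h1, h2, h3, h4]

omit [Fintype Λ] in
/-- The site activity of the representation lives on connected site sets: `ρ_c(A) = 0` unless `A` is the support of a connected bond set
`X ⊆ P` (`pushforwardActivity_eq_zero_of_not_mem_image`). -/
theorem pushforward_weight_eq_zero (W : Finset (Bond Λ) → ℂ) (P : Finset (Bond Λ)) {A : Finset Λ}
    (hA : A ∉ (connectedCellSets Bond.verts P).image (cellSupp Bond.verts)) :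
    pushforwardActivity (cellSupp Bond.verts) W (connectedCellSets Bond.verts P) A = 0 :=
  pushforwardActivity_eq_zero_of_not_mem_image hA

end Summit.Ventures.CertifiedManyBodySolver.Theorems.TcThermcert1.ZeroFreeCorridor

end
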